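import Summits.NavierStokesRegularity.NavierStokesRegularity.Theorems.OddMorawetzMorawetzKillsTypeIIsoStructureThreeUUT3
import Summits.NavierStokesRegularity.NavierStokesRegularity.Theorems.OddMorawetzMorawetzKillsTypeIIsoStructureThreeUAH7
import Summits.NavierStokesRegularity.NavierStokesRegularity.Theorems.OddMorawetzMorawetzKillsTypeIIsoStructureThreeAAA3

/-!
# Crux `MorawetzKillsTypeI` — `stub_isoStructureThree`: the structure of invariant weight-3 densities

For a smooth, pointwise cubic density of derivative weight 3 on 3-jets which is invariant under every linear isometry,
on SYMMETRIC jets `m = ∑_{l<17} d_l I_l` for the seventeen `δ`-contractions `I0 … I16` (the registered statement of the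
line's skeleton, crux stmt-NavierStokesRegularity-1377). Assembly of the block decomposition
(`IsoStructureThree.six_m_eq_blocks`) with the three generated block theorems `block_uuT`, `block_uAH`, `block_AAA`
(symmetry and isometry invariance of `T = D³m(0)`, and the `so(3)` equations from `stub_infinitesimalInvariance`).
Everything is proved; no definitions.
-/

noncomputable section

open scoped BigOperators

set_option linter.dupNamespace false

namespace Summit.NavierStokesRegularity.NavierStokesRegularity.Theorems

open Summit.NavierStokesRegularity.NavierStokesRegularity.Theorems.OddMorawetz

/-- A sum over `Fin 17`, written out (right-nested). -/
theorem isoStructureThree_sum_fin17 (f : Fin 17 → ℝ) :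
    ∑ l : Fin 17, f l = f 0 + (f 1 + (f 2 + (f 3 + (f 4 + (f 5 + (f 6 + (f 7 + (f 8 + (f 9 + (f 10 + (f 11 + (f 12 +
      (f 13 + (f 14 + (f 15 + f 16))))))))))))))) := by
  simp only [Fin.sum_univ_succ, Fin.sum_univ_zero, Fin.isValue, add_zero]
  rfl

set_option linter.unusedVariables false in
/-- **`stub_isoStructureThree`** (crux stmt-NavierStokesRegularity-1377, line `registered`): an isometry-invariant,
smooth, pointwise cubic, derivative-weight-3 density on 3-jets is, on symmetric jets, a real combination of the 17
`δ`-contractions `I0 … I16`. (The registered statement shares its `let`-block with `stub_isoNullThree`; the vorticity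
form `r` and the transfer coefficients `α` are not used by THIS statement, whence the `unusedVariables` exemption.) -/
theorem stub_isoStructureThree :
    let e : Fin 3 → E3 := fun i => EuclideanSpace.single i (1 : ℝ);
    let ω : (E3 [×1]→L[ℝ] E3) → E3 := fun A =>
      WithLp.toLp 2 ![A (fun _ => e 1) 2 - A (fun _ => e 2) 1, A (fun _ => e 2) 0 - A (fun _ => e 0) 2,
        A (fun _ => e 0) 1 - A (fun _ => e 1) 0];
    let r : Jet3 → ℝ := fun z => inner ℝ (ω z.2.1) (z.2.1 (fun _ => ω z.2.1));
    let I0 : Jet3 → ℝ := fun z => ∑ i0 : Fin 3, ∑ i1 : Fin 3, ∑ i2 : Fin 3, z.1 i0 * z.1 i0 * z.2.2.2 ![e i1, e i2, e i2] i1;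
    let I1 : Jet3 → ℝ := fun z => ∑ i0 : Fin 3, ∑ i1 : Fin 3, ∑ i2 : Fin 3, z.1 i0 * z.1 i1 * z.2.2.2 ![e i1, e i2, e i2] i0;
    let I2 : Jet3 → ℝ := fun z => ∑ i0 : Fin 3, ∑ i1 : Fin 3, ∑ i2 : Fin 3, z.1 i0 * z.1 i1 * z.2.2.2 ![e i0, e i1, e i2] i2;
    let I3 : Jet3 → ℝ := fun z => ∑ i0 : Fin 3, ∑ i1 : Fin 3, ∑ i2 : Fin 3, z.1 i0 * z.2.1 (fun _ => e i1) i0 * z.2.2.1 ![e i2, e i2] i1;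
    let I4 : Jet3 → ℝ := fun z => ∑ i0 : Fin 3, ∑ i1 : Fin 3, ∑ i2 : Fin 3, z.1 i0 * z.2.1 (fun _ => e i1) i0 * z.2.2.1 ![e i1, e i2] i2;
    let I5 : Jet3 → ℝ := fun z => ∑ i0 : Fin 3, ∑ i1 : Fin 3, ∑ i2 : Fin 3, z.1 i0 * z.2.1 (fun _ => e i0) i1 * z.2.2.1 ![e i2, e i2] i1;
    let I6 : Jet3 → ℝ := fun z => ∑ i0 : Fin 3, ∑ i1 : Fin 3, ∑ i2 : Fin 3, z.1 i0 * z.2.1 (fun _ => e i0) i1 * z.2.2.1 ![e i1, e i2] i2;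
    let I7 : Jet3 → ℝ := fun z => ∑ i0 : Fin 3, ∑ i1 : Fin 3, ∑ i2 : Fin 3, z.1 i0 * z.2.1 (fun _ => e i1) i1 * z.2.2.1 ![e i2, e i2] i0;
    let I8 : Jet3 → ℝ := fun z => ∑ i0 : Fin 3, ∑ i1 : Fin 3, ∑ i2 : Fin 3, z.1 i0 * z.2.1 (fun _ => e i2) i1 * z.2.2.1 ![e i1, e i2] i0;
    let I9 : Jet3 → ℝ := fun z => ∑ i0 : Fin 3, ∑ i1 : Fin 3, ∑ i2 : Fin 3, z.1 i0 * z.2.1 (fun _ => e i1) i1 * z.2.2.1 ![e i0, e i2] i2;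
    let I10 : Jet3 → ℝ := fun z => ∑ i0 : Fin 3, ∑ i1 : Fin 3, ∑ i2 : Fin 3, z.1 i0 * z.2.1 (fun _ => e i2) i1 * z.2.2.1 ![e i0, e i2] i1;
    let I11 : Jet3 → ℝ := fun z => ∑ i0 : Fin 3, ∑ i1 : Fin 3, ∑ i2 : Fin 3, z.1 i0 * z.2.1 (fun _ => e i2) i1 * z.2.2.1 ![e i0, e i1] i2;
    let I12 : Jet3 → ℝ := fun z => ∑ i0 : Fin 3, ∑ i1 : Fin 3, ∑ i2 : Fin 3, z.2.1 (fun _ => e i0) i0 * z.2.1 (fun _ => e i1) i1 * z.2.1 (fun _ => e i2) i2;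
    let I13 : Jet3 → ℝ := fun z => ∑ i0 : Fin 3, ∑ i1 : Fin 3, ∑ i2 : Fin 3, z.2.1 (fun _ => e i0) i0 * z.2.1 (fun _ => e i2) i1 * z.2.1 (fun _ => e i2) i1;
    let I14 : Jet3 → ℝ := fun z => ∑ i0 : Fin 3, ∑ i1 : Fin 3, ∑ i2 : Fin 3, z.2.1 (fun _ => e i0) i0 * z.2.1 (fun _ => e i2) i1 * z.2.1 (fun _ => e i1) i2;
    let I15 : Jet3 → ℝ := fun z => ∑ i0 : Fin 3, ∑ i1 : Fin 3, ∑ i2 : Fin 3, z.2.1 (fun _ => e i1) i0 * z.2.1 (fun _ => e i2) i0 * z.2.1 (fun _ => e i2) i1;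
    let I16 : Jet3 → ℝ := fun z => ∑ i0 : Fin 3, ∑ i1 : Fin 3, ∑ i2 : Fin 3, z.2.1 (fun _ => e i1) i0 * z.2.1 (fun _ => e i0) i2 * z.2.1 (fun _ => e i2) i1;
    let I : Fin 17 → Jet3 → ℝ := ![I0, I1, I2, I3, I4, I5, I6, I7, I8, I9, I10, I11, I12, I13, I14, I15, I16];
    let α : Fin 17 → ℝ := ![0, -1, 0, 0, 0, 1, 0, 0, 1, 0, 0, 0, 0, 0, 0, -1, 0];
    let Symm : Jet3 → Prop := fun z =>
      (∀ (h : Fin 2 → E3) (σ : Equiv.Perm (Fin 2)), z.2.2.1 (h ∘ σ) = z.2.2.1 h) ∧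
      (∀ (h : Fin 3 → E3) (σ : Equiv.Perm (Fin 3)), z.2.2.2 (h ∘ σ) = z.2.2.2 h);
    let J := fun (v : E3 → E3) (x : E3) => ((v x, iteratedFDeriv ℝ 1 v x, iteratedFDeriv ℝ 2 v x, iteratedFDeriv ℝ 3 v x) : Jet3);
    ∀ (m : Jet3 → ℝ), ContDiff ℝ (⊤ : ℕ∞) m → (∀ (μ : ℝ) z, m (μ • z) = μ ^ 3 * m z) →
      (∀ (s : ℝ), 0 < s → ∀ (z₀ : E3) (z₁ : E3 [×1]→L[ℝ] E3) (z₂ : E3 [×2]→L[ℝ] E3) (z₃ : E3 [×3]→L[ℝ] E3),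
          m (z₀, s • z₁, (s ^ 2) • z₂, (s ^ 3) • z₃) = s ^ 3 * m (z₀, z₁, z₂, z₃)) →
      (∀ (g : E3 ≃ₗᵢ[ℝ] E3) (z : Jet3), m (jetAct g z) = m z) →
      ∃ d : Fin 17 → ℝ, ∀ z : Jet3, Symm z → m z = ∑ l : Fin 17, d l * I l z := by
  intro e ω r I0 I1 I2 I3 I4 I5 I6 I7 I8 I9 I10 I11 I12 I13 I14 I15 I16 I α Symm J m hm hcub hwt hinv
  have hTsym := IsoStructureThree.T_symm hm
  have hTinv := IsoStructureThree.T_inv hm hinv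
  have hso3 := stub_infinitesimalInvariance m hm hinv
  obtain ⟨d0, d1, d2, hB1⟩ := IsoStructureThree.block_uuT (iteratedFDeriv ℝ 3 m 0) hTsym hTinv hso3
  obtain ⟨d3, d4, d5, d6, d7, d8, d9, d10, d11, hB2⟩ := IsoStructureThree.block_uAH (iteratedFDeriv ℝ 3 m 0) hTsym hTinv hso3
  obtain ⟨d12, d13, d14, d15, d16, hB3⟩ := IsoStructureThree.block_AAA (iteratedFDeriv ℝ 3 m 0) hTsym hTinv hso3
  refine ⟨![d0, d1, d2, d3, d4, d5, d6, d7, d8, d9, d10, d11, d12, d13, d14, d15, d16], fun z hz => ?_⟩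
  obtain ⟨hz2, hz3⟩ := hz
  have h6 := IsoStructureThree.six_m_eq_blocks hm hcub hwt z
  have e1 := hB1 z hz2 hz3
  have e2 := hB2 z hz2 hz3
  have e3 := hB3 z hz2 hz3
  rw [isoStructureThree_sum_fin17]
  simp only [I, Fin.isValue, Matrix.cons_val_zero, Matrix.cons_val_one, Matrix.cons_val_two, Matrix.head_cons,
    Matrix.tail_cons, Matrix.cons_val]
  simp only [I0, I1, I2, I3, I4, I5, I6, I7, I8, I9, I10, I11, I12, I13, I14, I15, I16, e]
  linear_combination (1 / 6 : ℝ) * h6 + (1 / 6 : ℝ) * e1 + (1 / 6 : ℝ) * e2 + (1 / 6 : ℝ) * e3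

end Summit.NavierStokesRegularity.NavierStokesRegularity.Theorems

end

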